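import Summits.HubbardSuperconductivity.HubbardSuperconductivity.Theorems.AnisotropyChordTransferFibre3N1RowExprB

/-!
# Route `AnisotropyChord` / H0 rotor rung, LEVEL 2 row `N₁`: the `RExpr` transcription, part 3 — the object `⟨Π⁰,C0⟩` AT ORDER `θ²`

Blueprint: HOME/hubbard-h0-rotor-p2/level2_N1_hat_hybrid.py (§PC0) and check_closed_forms.py (the explicit full-torus sums below agree
with the direct torus sums to 1e-6 at three ground points).  The object is `Q̂ := θ⁶·Σ_e Σ_k |φ̂_e(k)|² F₂(k)`
(`⟨Π⁰,C0⟩ = −(3/2)·Q̂/(4π²θ⁴)`); since `Q̂ = O(θ²)` while `B̂, P̂` are `O(1)`, the margin needs `Q̂₁ := Q̂/θ²` (design insight of the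
memo LEVEL2-EVAL-DESIGN-g4.md: "order-t extraction").  Every piece of the blueprint carries an explicit factor `t = θ²`, which is
removed HERE symbolically — no division by `t` ever occurs (the cell box has `t ∈ (0, 0.00241]`).
HYBRID treatment (validated, costs < 0.01 in `c₁`): `F̂(q)` uses the exact named tail `t̂(q)` for `|q|∞ = 1` (`TfunNamed`), but the
energy-current kernel is bounded through its closed BASE part `μ_e` for every `k ≠ 0` (`MuNormSq`, `PhiHatNearClosed` with the actual
`|t(k)|` and `τ̄`): no `TauNamed`, no transverse sums.
New unknowns: `w_n := (1 − cos nθ)/θ² ∈ [n²/2 − n⁴t/24, n²/2]`, `1 ≤ n ≤ M` (indices after the cosine block).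
Contents: `taubar`, `Eh`, `bh`, `tTerm`, `wOf`, the per-(q,e) kernel bounds `m2` (`= |μ̂_e|²/t`), `p1` (`= P̂_e/√t`), `kerLo/kerHi`,
the block, the special point `Q1zero = 4γ̂²F̂(0)/t`, the explicit outer closed sum `Q1closedFull = Σ_{k≠0} (M̂/t)ĉ`, the two outer tail
majorants `vDfull`, `vYfull` (minus their block parts, clipped at 0), and ★ `Q1lo M₂`, `Q1hi M₂`.  No soundness here
(`…N1RowExprSound`).
Prover seat `hubbard-h0-rotor-p2` g4; helper for piece A = stmt-HubbardSuperconductivity-23918 of rung 19089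
(`--supports`, helper class).  Nothing here proves superconductivity in the Hubbard model; computable helper definitions of ONE
conditional reduction (the GM₃ ∀L certificate, Level-2 row `N₁`); the rotor TARGET as originally worded stays FALSE (g15 verdict).
Mathlib + the tree only; no sorry.
-/

set_option linter.dupNamespace false
set_option autoImplicit false

open Literature.Analysis.ValidatedNumerics

namespace Summit.HubbardSuperconductivity.HubbardSuperconductivity.Theorems.AnisotropyChord.Transfer.Fibre3.L2.N1

/-! ## New unknowns and per-momentum scalars -/

/-- the unknown `w_n = (1 − cos nθ)/θ²`, `1 ≤ n ≤ M`, boxed in `[n²/2 − n⁴t/24, n²/2]` (indices after the cosine block). -/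
def vW (M : ℕ) (n : ℕ) : RExpr := .var (19 + 2 * (gridPts M).length + M + (n - 1))
/-- `w` at the integer `n = q·e`: `0` for `n = 0`, else the unknown of `|n|`. -/
def wOf (M : ℕ) (n : ℤ) : RExpr := if n = 0 then cst 0 else vW M n.natAbs
/-- `τ̄ = 2η(1 − a + (2a − a²)ε + σ̂/(4π²))` (the un-hatted `τ`-tail constant of `TauTailBound`; `|τ̂_e| ≤ tτ̄/2`). -/
def taubar : RExpr :=
  .mul (.mul (cst 2) eta) (rsum [cst 1, .neg vA, .mul (.sub (.mul (cst 2) vA) dd) eps, .mul sig (.inv (.mul (cst 4) vPi2))])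
/-- `Ê(q) = θ²E(q)·… = (1 + νĝ(q))/ĝ(q)` (`tE = 2ε̂ = (1+νĝ)/ĝ`). -/
def Eh (M : ℕ) (q : ℤ × ℤ) : RExpr := .mul (.add (cst 1) (.mul vNu (vG M q))) (.inv (vG M q))
/-- `β̂(q) = c_sĝ(q) + a²t/2`. -/
def bh (M : ℕ) (q : ℤ × ℤ) : RExpr := .add (.mul cs (vG M q)) (.mul (.mul dd vT) (cst (1/2)))
/-- the tail term `t̂(q)`: exact at named `q`, the unknown otherwise (`F̂ = ĉ + tTerm`). -/
def tTerm (M : ℕ) (q : ℤ × ℤ) : RExpr := if isNamed q then tnamed M q else vTt M q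
/-- the constant `m₀ = 13/10` of the Young split in the `τ`-deviation bound (blueprint default). -/
def m0 : RExpr := cst (13/10)

/-! ## The kernel `|φ̂_e(q)|²/t` on the block -/

/-- the four lattice directions. -/
def E4 : List (ℤ × ℤ) := [(1, 0), (-1, 0), (0, 1), (0, -1)]
/-- `n = q·e`. -/
def qdot (q e : ℤ × ℤ) : ℤ := q.1 * e.1 + q.2 * e.2
/-- `m2(q,e) = |μ̂_e(q)|²/t = 2w_nβ̂² + ½qq²t(2 − tw_n)` (`MuNormSq`; the cross term has zero real part). -/
def m2 (M : ℕ) (q e : ℤ × ℤ) : RExpr :=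
  let w := wOf M (qdot q e)
  .add (.mul (.mul (cst 2) w) (.sq (bh M q))) (.mul (.mul (.mul (cst (1/2)) (.sq qq)) vT) (.sub (cst 2) (.mul vT w)))
/-- `p1(q,e) = P̂_e(q)/√t = √(w_n/2)·|t̂(q)| + √t·τ̄/2` (`PhiHatNearClosed`, `s_e² = (1 − cos φ)/2`). -/
def p1 (M : ℕ) (q e : ℤ × ℤ) : RExpr :=
  .add (.mul (.sqrt (.mul (wOf M (qdot q e)) (cst (1/2)))) (.abs (tTerm M q))) (.mul (.mul (.sqrt vT) taubar) (cst (1/2)))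
/-- lower kernel bound `max(√m2 − p1, 0)² ≤ |φ̂_e|²/t`. -/
def kerLo (M : ℕ) (q e : ℤ × ℤ) : RExpr := .sq (.max (.sub (.sqrt (m2 M q e)) (p1 M q e)) (cst 0))
/-- upper kernel bound `|φ̂_e|²/t ≤ (√m2 + p1)²`. -/
def kerHi (M : ℕ) (q e : ℤ × ℤ) : RExpr := .sq (.add (.sqrt (m2 M q e)) (p1 M q e))
/-- lower block term: `Σ_e min(kerLo·F̂, kerHi·F̂)` (valid whatever the sign of `F̂`). -/
def qBlockLo (M : ℕ) (q : ℤ × ℤ) : RExpr :=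
  rsum (E4.map fun e => .min (.mul (kerLo M q e) (Fh M q)) (.mul (kerHi M q e) (Fh M q)))
/-- upper block term: `Σ_e max(kerLo·F̂, kerHi·F̂)`. -/
def qBlockHi (M : ℕ) (q : ℤ × ℤ) : RExpr :=
  rsum (E4.map fun e => .max (.mul (kerLo M q e) (Fh M q)) (.mul (kerHi M q e) (Fh M q)))

/-! ## Special point, outer closed part, outer tails (all at order `t`) -/

/-- `k = 0`: `4γ̂²F̂(0)/t = t(νF̂(0) + 4a(a+η))²F̂(0)/4` (`γ̂ = t(νF̂(0) + 4a(a+η))/4`). -/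
def Q1zero : RExpr :=
  .mul (.mul (.mul vT (.sq (.add (.mul vNu F0h) (.mul (.mul (cst 4) vA) (.add vA eta))))) F0h) (cst (1/4))
/-- `M1(q) = M̂(q)/t = 2β̂²Ê + ½qq²t(8 − tÊ)`. -/
def M1 (M : ℕ) (q : ℤ × ℤ) : RExpr :=
  .add (.mul (.mul (cst 2) (.sq (bh M q))) (Eh M q)) (.mul (.mul (.mul (cst (1/2)) (.sq qq)) vT) (.sub (cst 8) (.mul vT (Eh M q))))
/-- `4π² − t + νtŜ₁` (`= t·Σ_{k≠0} ĝÊ`). -/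
def sumGE : RExpr := .add (.sub (.mul (cst 4) vPi2) vT) (.mul (.mul vNu vT) S1h)
/-- ★ the explicit outer closed sum `Σ_{k≠0} M1(k)ĉ(k) =
 −[4c_s³(Ŝ₂+νŜ₃) + 6c_s²a²t(Ŝ₁+νŜ₂) + (3c_sa⁴ − c_sqq²)t(4π²−t+νtŜ₁) + 8π²t(a⁶ − qq²a²) + 8c_sqq²tŜ₁ + 4qq²a²t(4π²−t)]`. -/
def Q1closedFull : RExpr :=
  .neg (rsum [ .mul (.mul (cst 4) (cube cs)) (.add vS2 (.mul vNu vS3)),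
    .mul (.mul (.mul (.mul (cst 6) (.sq cs)) dd) vT) (.add S1h (.mul vNu vS2)),
    .mul (.mul (.sub (.mul (.mul (cst 3) cs) (.sq dd)) (.mul cs (.sq qq))) vT) sumGE,
    .mul (.mul (.mul (cst 8) vPi2) vT) (.sub (cube dd) (.mul (.sq qq) dd)),
    .mul (.mul (.mul (.mul (cst 8) cs) (.sq qq)) vT) S1h,
    .mul (.mul (.mul (.mul (cst 4) (.sq qq)) dd) vT) (.sub (.mul (cst 4) vPi2) vT) ])
/-- ★ `vDfull = κ·Σ_{k≠0} M1(k)ĝ(k) = κ[2c_s²(Ŝ₂+νŜ₃) + 2c_sD(Ŝ₁+νŜ₂) + ½(a⁴ − qq²)t(4π²−t+νtŜ₁) + 4qq²tŜ₁]`. -/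
def vDfull : RExpr :=
  .mul kap (rsum [ .mul (.mul (cst 2) (.sq cs)) (.add vS2 (.mul vNu vS3)),
    .mul (.mul (.mul (cst 2) cs) Dt) (.add S1h (.mul vNu vS2)),
    .mul (.mul (.mul (cst (1/2)) (.sub (.sq dd) (.sq qq))) vT) sumGE,
    .mul (.mul (.mul (cst 4) (.sq qq)) vT) S1h ])
/-- coefficient `A = 2κc_s + (τ̄/m₀)c_s² + κ²` of `ĝ²Ê` in `(Ŷ + ρ̂₂)/t`. -/
def cA : RExpr := rsum [ .mul (.mul (cst 2) kap) cs, .mul (.mul taubar (.inv m0)) (.sq cs), .sq kap ]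
/-- coefficient `B = κD + (τ̄/m₀)c_sD` of `ĝÊ`. -/
def cB : RExpr := .add (.mul kap Dt) (.mul (.mul (.mul taubar (.inv m0)) cs) Dt)
/-- `E₀' = (2m₀ + 4qq)τ̄ + 2τ̄²` (the constant term is `tE₀'`). -/
def cE0 : RExpr := .add (.mul (.add (.mul (cst 2) m0) (.mul (cst 4) qq)) taubar) (.mul (cst 2) (.sq taubar))
/-- `G = 8qqκ` (coefficient of `ĝ`). -/
def cG : RExpr := .mul (.mul (cst 8) qq) kap
/-- `c₂ = 2c_s + κ`. -/
def c2 : RExpr := .add (.mul (cst 2) cs) kap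
/-- ★ `vYfull = Σ_{k≠0} ((Ŷ+ρ̂₂)/t)(k)·acx(k)`, `acx = c₂ĝ + D`:
`A c₂(Ŝ₂+νŜ₃) + (AD + Bc₂)(Ŝ₁+νŜ₂) + (κa⁴ + (τ̄/m₀)c_sa⁴ + (τ̄/m₀)(a⁴/4)c₂)t(4π²−t+νtŜ₁) + 4π²t(τ̄/m₀)a⁶
 + (tE₀'c₂ + GD)Ŝ₁ + E₀'a²t(4π²−t) + Gc₂Ŝ₂`. -/
def vYfull : RExpr :=
  let tm := .mul taubar (.inv m0)
  rsum [ .mul (.mul cA c2) (.add vS2 (.mul vNu vS3)),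
    .mul (.add (.mul cA Dt) (.mul cB c2)) (.add S1h (.mul vNu vS2)),
    .mul (.mul (rsum [ .mul kap (.sq dd), .mul (.mul tm cs) (.sq dd), .mul (.mul (.mul tm (.sq dd)) (cst (1/4))) c2 ]) vT) sumGE,
    .mul (.mul (.mul (.mul (cst 4) vPi2) vT) tm) (cube dd),
    .mul (.add (.mul (.mul vT cE0) c2) (.mul cG Dt)) S1h,
    .mul (.mul (.mul cE0 dd) vT) (.sub (.mul (cst 4) vPi2) vT),
    .mul (.mul cG c2) vS2 ]
/-- per-momentum `(Ŷ + ρ̂₂)/t = 2κβ̂ĝÊ + (τ̄/m₀)β̂²Ê + (2m₀+4qq)τ̄t + 8qqκĝ + κ²ĝ²Ê + 2tτ̄²`. -/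
def YR1 (M : ℕ) (q : ℤ × ℤ) : RExpr :=
  rsum [ .mul (.mul (.mul (.mul (cst 2) kap) (bh M q)) (vG M q)) (Eh M q),
    .mul (.mul (.mul taubar (.inv m0)) (.sq (bh M q))) (Eh M q),
    .mul (.mul (.add (.mul (cst 2) m0) (.mul (cst 4) qq)) taubar) vT,
    .mul (.mul (.mul (cst 8) qq) kap) (vG M q),
    .mul (.mul (.sq kap) (.sq (vG M q))) (Eh M q),
    .mul (.mul (cst 2) vT) (.sq taubar) ]
/-- `acx(q) = 2c_sĝ + D + κĝ`. -/
def acx (M : ℕ) (q : ℤ × ℤ) : RExpr := .add (ach M q) (.mul kap (vG M q))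
/-- the clipped outer tail `max(vDfull − κΣ_block M1ĝ, 0) + max(vYfull − Σ_block YR1·acx, 0)`. -/
def Q1tail (M2 : ℕ) : RExpr :=
  let M := M2 + 1
  .add (.max (.sub vDfull (.mul kap (rsum ((block1 M2).map fun q => .mul (M1 M q) (vG M q))))) (cst 0))
       (.max (.sub vYfull (rsum ((block1 M2).map fun q => .mul (YR1 M q) (acx M q)))) (cst 0))
/-- the outer closed part `Q1closedFull − Σ_block M1·ĉ`. -/
def Q1outer (M2 : ℕ) : RExpr :=
  let M := M2 + 1
  .sub Q1closedFull (rsum ((block1 M2).map fun q => .mul (M1 M q) (ch M q)))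
/-- ★ upper hatted bracket of `Q̂₁ = Q̂/θ²`. -/
def Q1hi (M2 : ℕ) : RExpr :=
  let M := M2 + 1
  rsum [ Q1zero, rsum ((block1 M2).map fun q => qBlockHi M q), Q1outer M2, Q1tail M2 ]
/-- ★ lower hatted bracket of `Q̂₁ = Q̂/θ²`. -/
def Q1lo (M2 : ℕ) : RExpr :=
  let M := M2 + 1
  rsum [ Q1zero, rsum ((block1 M2).map fun q => qBlockLo M q), Q1outer M2, .neg (Q1tail M2) ]

end Summit.HubbardSuperconductivity.HubbardSuperconductivity.Theorems.AnisotropyChord.Transfer.Fibre3.L2.N1
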